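import Mathlib.Analysis.SpecialFunctions.Log.Base
import Mathlib.Analysis.SpecialFunctions.Pow.Real
import Mathlib.Analysis.Asymptotics.Lemmas
import Mathlib.Analysis.Complex.ExponentialBounds
import Mathlib.Combinatorics.Additive.AP.Three.Behrend
import Mathlib.Data.Nat.Choose.Bounds
import Literature.Computability.AlgebraicComplexity.MatrixMultiplicationExponent
import Literature.Computability.AlgebraicComplexity.AsymptoticSpectrum
import Literature.Computability.AlgebraicComplexity.FlatteningBound
import Literature.Computability.AlgebraicComplexity.TensorRestrictionRank
import Literature.Computability.AlgebraicComplexity.CoppersmithWinograd1990Proofs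
import HarnessLib

/-!
# The Coppersmith–Winograd "easy" bound for an ABSTRACT tensor:
`T^{⊗3m} ≥ ⟨p_m⟩ ⊗ ⟨q^m,q^m,q^m⟩` and `R(T^{⊗N}) = O(ρ^{(1+ε)N})` imply `ω ≤ log_q(4ρ³/27)`
(route `MatrixMultiplication/AsymptoticRankCW`, support item `GlueDet3Omega` = `stmt-MatrixMultiplication-1889`)

The analytic half of the proof of `CoppersmithWinograd1990_asymptoticRank_form_holds`
(`CoppersmithWinograd1990Proofs.lean`: BCS 1997 Thm. 15.41 / Ex. 15.24(7), CGLV 2022 Thm. 1.1 and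
p. 3) uses the little Coppersmith–Winograd tensor only through the restrictions
`T_cw,q^{⊗3m} ≥ ⟨p_m⟩ ⊗ ⟨q^m,q^m,q^m⟩` with `288 C(2m,m) p_m ≥ C(3m,m) · rothNumberNat(3 C(2m,m))`.
Here the same argument is run for an arbitrary tensor `T` over `ℂ` satisfying these
restrictions (`omega_le_logb_of_laser_restrictions`), so that it applies verbatim to the skew
cousin `T_skewcw,q` and to the Levi-Civita tensor of the route's crux `BDet3AsymptoticRank`
("`T_skewcw,q` has the same block structure as `T_cw,q`, which immediately implies Theorem 1.1 also
holds for `T_skewcw,q`", Conner–Gesmundo–Landsberg–Ventura 2022, §2.2).  The proof is that of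
`CoppersmithWinograd1990_asymptoticRank_form_holds` with `T_cw,q` replaced by `T`: with
`a = ⌊(p_m/C_δ)^{1/(ω+δ)}⌋`, `R(⟨a,a,a⟩) ≤ p_m`, hence `(a q^m)^ω ≤ R(T^{⊗3m}) ≤ C_ε ρ^{3m(1+ε)}`
(rank step of the asymptotic sum inequality, `TensorRestrictionRank.lean`);
`C(3m,m) ≥ (27/4)^m/(3m+1)`, Behrend, and `m → ∞`, `δ, ε → 0` give `log(27/4) + ω log q ≤ 3 log ρ`.

References: P. Bürgisser, M. Clausen, M. A. Shokrollahi, *Algebraic Complexity Theory* (1997),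
Thm. 15.41 and its proof pp. 380–383, Rem. 15.44, Ex. 15.24(7); A. Conner, F. Gesmundo,
J. M. Landsberg, E. Ventura, comput. complexity 31 (2022) = arXiv:1909.04785, Thm. 1.1, p. 3, §2.2;
D. Coppersmith, S. Winograd, J. Symbolic Comput. 9 (1990), §6.
-/

-- the Theorems namespace `Summit.MatrixMultiplication.MatrixMultiplication.Theorems` repeats the
-- summit name by design (single-problem summit, D-0017), which trips `linter.dupNamespace`
set_option linter.dupNamespace false

noncomputable section

open scoped BigOperators
open Filter Asymptotics Finset Literature.Computability.AlgebraicComplexity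

namespace Summit.MatrixMultiplication.MatrixMultiplication.Theorems

/-- **The Coppersmith–Winograd bound for an abstract tensor** (BCS 1997 Thm. 15.41 / Ex. 15.24(7),
CGLV 2022 Thm. 1.1 with p. 3 and §2.2, in growth form): let `T` be a tensor over `ℂ`, `q ≥ 2`,
`ρ > 0`, such that for every `m ≥ 1` the power `T^{⊗3m}` restricts to `⟨p_m⟩ ⊗ ⟨q^m,q^m,q^m⟩` for
some `p_m` with `288 C(2m,m) p_m ≥ C(3m,m) · rothNumberNat(3 C(2m,m))`, and such that
`R(T^{⊗N}) = O(ρ^{(1+ε)N})` for every `ε > 0` (i.e. `R̃(T) ≤ ρ`). Then `ω(ℂ) ≤ log_q(4ρ³/27)`.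
The proof is the restriction-only laser method of `CoppersmithWinograd1990_asymptoticRank_form_holds`,
verbatim with `T_cw,q` replaced by `T`.
[cite: BurgisserClausenShokrollahi1997, Thm. 15.41 (proof, pp. 380–383) and Ex. 15.24(7)] -/
theorem omega_le_logb_of_laser_restrictions {ι κ μ : Type} [Fintype ι] [Fintype κ] [Fintype μ]
    (T : ι → κ → μ → ℂ) (q : ℕ) (hq : 2 ≤ q) (ρ : ℝ) (hρ : 0 < ρ)
    (hres : ∀ m : ℕ, 1 ≤ m → ∃ p : ℕ,
        (3 * m).choose m * rothNumberNat (3 * (2 * m).choose m) ≤ 288 * (2 * m).choose m * p ∧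
        TensorRestrictsTo (kroneckerPow T (3 * m))
          (kroneckerTensor (unitTensor ℂ p) (matMulTensor ℂ (q ^ m) (q ^ m) (q ^ m))))
    (hyp : ∀ ε : ℝ, 0 < ε →
      (fun N : ℕ => (tensorRank (kroneckerPow T N) : ℝ)) =O[atTop]
        fun N : ℕ => ρ ^ ((1 + ε) * N)) :
    omega ℂ ≤ Real.logb q (4 * ρ ^ 3 / 27) := by
  have hq1 : (1 : ℝ) < q := by exact_mod_cast hq
  have hq0 : (0 : ℝ) < q := by positivity
  have hlogq : 0 < Real.log q := Real.log_pos hq1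
  have hω2 : 2 ≤ omega ℂ := omega_two_le ℂ
  have hω0 : 0 < omega ℂ := by linarith
  obtain ⟨L, hL⟩ : ∃ L : ℝ, L = Real.log (27 / 4) := ⟨_, rfl⟩
  have hL0 : 0 < L := hL ▸ Real.log_pos (by norm_num)
  have hL2 : L < 2 := by rw [hL, Real.log_lt_iff_lt_exp (by norm_num)]; exact exp_two_gt
  have hlog3 : Real.log 3 ≤ 2 := by
    rw [Real.log_le_iff_le_exp (by norm_num)]; linarith [exp_two_gt]
  have hlog4 : Real.log 4 ≤ 2 := by
    rw [Real.log_le_iff_le_exp (by norm_num)]; linarith [exp_two_gt]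
  -- MAIN CLAIM: for all `ε, δ > 0`, `ω (L/(ω+δ) + log q) ≤ 3 (1+ε) log ρ`
  have main : ∀ ε : ℝ, 0 < ε → ∀ δ : ℝ, 0 < δ →
      omega ℂ * (L / (omega ℂ + δ) + Real.log q) ≤ 3 * (1 + ε) * Real.log ρ := by
    intro ε hε δ hδ
    have hωδ : 0 < omega ℂ + δ := by linarith
    -- the constant of the hypothesis
    obtain ⟨Cε, hCε, hb⟩ := bound_of_isBigO_nat_atTop (hyp ε hε)
    have hrank : ∀ N : ℕ, (tensorRank (kroneckerPow T N) : ℝ) ≤ Cε * ρ ^ ((1 + ε) * N) := by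
      intro N
      have hg : ρ ^ ((1 + ε) * N) ≠ 0 := (Real.rpow_pos_of_pos hρ _).ne'
      have := hb hg
      rwa [Real.norm_of_nonneg (Nat.cast_nonneg _),
        Real.norm_of_nonneg (Real.rpow_pos_of_pos hρ _).le] at this
    -- `ω` is an exponent
    obtain ⟨Cδ, hCδ, hCδb⟩ := exists_tensorRank_matMulTensor_le_rpow ℂ hδ
    -- the restrictions `T^{⊗3m} ≥ ⟨P m⟩ ⊗ ⟨q^m,q^m,q^m⟩`
    choose! P hPsize hPres using hres
    -- (E3) `log (P m) ≥ m L - 12 √m - log 96` for `m ≥ 1`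
    have hE3 : ∀ m : ℕ, 1 ≤ m → 0 < (P m : ℝ) ∧
        (m : ℝ) * L - 12 * √(m : ℝ) - Real.log 96 ≤ Real.log (P m) := by
      intro m hm
      have hm1 : (1 : ℝ) ≤ m := by exact_mod_cast hm
      set f := (2 * m).choose m with hf
      have hf1 : 1 ≤ f := Nat.choose_pos (by omega)
      have hf0 : (0 : ℝ) < f := by exact_mod_cast hf1
      have hf4 : (f : ℝ) ≤ 4 ^ m := by
        have : f ≤ 2 ^ (2 * m) := Nat.choose_le_two_pow _ _
        calc (f : ℝ) ≤ ((2 ^ (2 * m) : ℕ) : ℝ) := by exact_mod_cast this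
          _ = 4 ^ m := by push_cast; rw [pow_mul]; norm_num
      -- Behrend
      have hB := Behrend.roth_lower_bound (N := 3 * f)
      have hsize : ((3 * m).choose m : ℝ) * rothNumberNat (3 * f) ≤ 288 * f * P m := by
        exact_mod_cast hPsize m hm
      set s : ℝ := 4 * √(Real.log ((3 * f : ℕ) : ℝ)) with hs
      have hexp : 0 < Real.exp (-s) := Real.exp_pos _
      have hB' : ((3 * f : ℕ) : ℝ) * Real.exp (-s) ≤ rothNumberNat (3 * f) := by
        rw [hs, show -(4 * √(Real.log ((3 * f : ℕ) : ℝ))) = -4 * √(Real.log ((3 * f : ℕ) : ℝ)) by ring]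
        exact hB
      have hC0 : (0 : ℝ) ≤ (3 * m).choose m := Nat.cast_nonneg _
      -- `C e^{-s} ≤ 96 P`
      have h1 : ((3 * m).choose m : ℝ) * Real.exp (-s) ≤ 96 * P m := by
        have h3f : (0 : ℝ) < ((3 * f : ℕ) : ℝ) := by positivity
        refine le_of_mul_le_mul_right ?_ h3f
        calc ((3 * m).choose m : ℝ) * Real.exp (-s) * ((3 * f : ℕ) : ℝ)
            = ((3 * m).choose m : ℝ) * (((3 * f : ℕ) : ℝ) * Real.exp (-s)) := by ring
          _ ≤ ((3 * m).choose m : ℝ) * rothNumberNat (3 * f) := mul_le_mul_of_nonneg_left hB' hC0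
          _ ≤ 288 * f * P m := hsize
          _ = 96 * P m * ((3 * f : ℕ) : ℝ) := by push_cast; ring
      have hP0 : 0 < (P m : ℝ) := by
        have : 0 < ((3 * m).choose m : ℝ) * Real.exp (-s) :=
          mul_pos (by exact_mod_cast Nat.choose_pos (by omega)) hexp
        linarith
      refine ⟨hP0, ?_⟩
      -- `(27/4)^m e^{-s} ≤ 96 (3m+1) P`
      have h2 : ((27 : ℝ) / 4) ^ m * Real.exp (-s) ≤ 96 * (3 * m + 1) * P m := by
        calc ((27 : ℝ) / 4) ^ m * Real.exp (-s) ≤ (3 * m + 1) * ((3 * m).choose m : ℝ) * Real.exp (-s) :=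
              mul_le_mul_of_nonneg_right (pow_le_mul_choose_three_mul m) hexp.le
          _ = (3 * m + 1) * (((3 * m).choose m : ℝ) * Real.exp (-s)) := by ring
          _ ≤ (3 * m + 1) * (96 * P m) := mul_le_mul_of_nonneg_left h1 (by positivity)
          _ = 96 * (3 * m + 1) * P m := by ring
      have h3 : (m : ℝ) * L - s ≤ Real.log 96 + Real.log (3 * m + 1) + Real.log (P m) := by
        have hlhs : Real.log (((27 : ℝ) / 4) ^ m * Real.exp (-s)) = m * L - s := by
          rw [Real.log_mul (by positivity) hexp.ne', Real.log_pow, Real.log_exp, hL]; ring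
        have hrhs : Real.log (96 * (3 * m + 1) * P m) =
            Real.log 96 + Real.log (3 * m + 1) + Real.log (P m) := by
          rw [Real.log_mul (by positivity) hP0.ne', Real.log_mul (by norm_num) (by positivity)]
        rw [← hlhs, ← hrhs]
        exact Real.log_le_log (by positivity) h2
      -- `s ≤ 8 √m` and `log (3m+1) ≤ 4 √m`
      have hs8 : s ≤ 8 * √(m : ℝ) := by
        have hlog3f : Real.log ((3 * f : ℕ) : ℝ) ≤ 4 * m := by
          have : ((3 * f : ℕ) : ℝ) ≤ 3 * 4 ^ m := by push_cast; linarith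
          calc Real.log ((3 * f : ℕ) : ℝ) ≤ Real.log (3 * 4 ^ m) :=
                Real.log_le_log (by positivity) this
            _ = Real.log 3 + m * Real.log 4 := by
                rw [Real.log_mul (by norm_num) (by positivity), Real.log_pow]
            _ ≤ 2 + m * 2 := by nlinarith
            _ ≤ 4 * m := by linarith
        have : √(Real.log ((3 * f : ℕ) : ℝ)) ≤ 2 * √(m : ℝ) := by
          calc √(Real.log ((3 * f : ℕ) : ℝ)) ≤ √(4 * m) := Real.sqrt_le_sqrt hlog3f
            _ = 2 * √(m : ℝ) := by
                rw [Real.sqrt_mul (by norm_num), show (4 : ℝ) = 2 ^ 2 by norm_num,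
                  Real.sqrt_sq (by norm_num)]
        rw [hs]; linarith
      have hl4 : Real.log (3 * m + 1) ≤ 4 * √(m : ℝ) := by
        calc Real.log (3 * m + 1) ≤ 2 * √(3 * m + 1) := log_le_two_mul_sqrt (by positivity)
          _ ≤ 2 * √(4 * m) := by
              refine mul_le_mul_of_nonneg_left (Real.sqrt_le_sqrt (by linarith)) (by norm_num)
          _ = 4 * √(m : ℝ) := by
              rw [Real.sqrt_mul (by norm_num), show (4 : ℝ) = 2 ^ 2 by norm_num,
                Real.sqrt_sq (by norm_num)]; ring
      linarith
    -- the threshold beyond which `P m / Cδ ≥ 2^{ω+δ}`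
    obtain ⟨m₁, hm₁⟩ := exists_nat_forall_sqrt_le 12
      (Real.log 96 + Real.log Cδ + (omega ℂ + δ) * Real.log 2) L hL0
    -- the inequality for large `m`
    refine le_of_forall_large_mul_le (c := 12 * (omega ℂ / (omega ℂ + δ)))
      (c' := omega ℂ / (omega ℂ + δ) * (Real.log 96 + Real.log Cδ) + omega ℂ * Real.log 2 +
        Real.log Cε) ⟨max m₁ 1, fun m hm => ?_⟩
    have hm1 : 1 ≤ m := le_trans (le_max_right _ _) hm
    have hmm₁ : m₁ ≤ m := le_trans (le_max_left _ _) hm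
    obtain ⟨hP0, hlogP⟩ := hE3 m hm1
    have hthr := hm₁ m hmm₁
    -- `X = (P/Cδ)^{1/(ω+δ)} ≥ 2`
    set X : ℝ := ((P m : ℝ) / Cδ) ^ (omega ℂ + δ)⁻¹ with hX
    have hPC : 0 < (P m : ℝ) / Cδ := div_pos hP0 hCδ
    have hX0 : 0 ≤ X := Real.rpow_nonneg hPC.le _
    have hlogX : Real.log X = (Real.log (P m) - Real.log Cδ) / (omega ℂ + δ) := by
      rw [hX, Real.log_rpow hPC, Real.log_div hP0.ne' hCδ.ne']; ring
    have hX2 : 2 ≤ X := by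
      have h2 : (2 : ℝ) ^ (omega ℂ + δ) ≤ (P m : ℝ) / Cδ := by
        rw [← Real.log_le_log_iff (by positivity) hPC, Real.log_rpow (by norm_num),
          Real.log_div hP0.ne' hCδ.ne']
        linarith
      calc (2 : ℝ) = ((2 : ℝ) ^ (omega ℂ + δ)) ^ (omega ℂ + δ)⁻¹ :=
            (Real.rpow_rpow_inv (by norm_num) hωδ.ne').symm
        _ ≤ X := Real.rpow_le_rpow (by positivity) h2 (inv_nonneg.2 hωδ.le)
    -- `a = ⌊X⌋`
    set a : ℕ := ⌊X⌋₊ with ha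
    have ha2 : 2 ≤ a := Nat.le_floor (by exact_mod_cast hX2)
    have haX : (a : ℝ) ≤ X := Nat.floor_le hX0
    have haX' : X / 2 ≤ a := by have := Nat.lt_floor_add_one X; linarith
    have ha0 : (0 : ℝ) < a := by exact_mod_cast (by omega : 0 < a)
    -- `R(⟨a,a,a⟩) ≤ P m`
    have hap : tensorRank (matMulTensor ℂ a a a) ≤ P m := by
      have h1 := hCδb a (by omega)
      have h2 : (a : ℝ) ^ (omega ℂ + δ) ≤ X ^ (omega ℂ + δ) :=
        Real.rpow_le_rpow ha0.le haX hωδ.le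
      have h3 : X ^ (omega ℂ + δ) = (P m : ℝ) / Cδ := by
        rw [hX]; exact Real.rpow_inv_rpow hPC.le hωδ.ne'
      have h4 : (tensorRank (matMulTensor ℂ a a a) : ℝ) ≤ P m := by
        calc (tensorRank (matMulTensor ℂ a a a) : ℝ) ≤ Cδ * (a : ℝ) ^ (omega ℂ + δ) := h1
          _ ≤ Cδ * X ^ (omega ℂ + δ) := mul_le_mul_of_nonneg_left h2 hCδ.le
          _ = P m := by rw [h3]; field_simp
      exact_mod_cast h4
    -- (E1) `(a q^m)^ω ≤ Cε ρ^{(1+ε) 3m}`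
    have hqm : (2 : ℕ) ≤ q ^ m := le_trans hq (Nat.le_self_pow (by omega) q)
    have haq : 2 ≤ a * q ^ m := le_trans hqm (Nat.le_mul_of_pos_left _ (by omega))
    have hE1 := (rpow_omega_mul_le_tensorRank_of_restrictsTo ℂ _ (hPres m hm1) hap haq).trans
      (hrank (3 * m))
    have haq0 : (0 : ℝ) < (a : ℝ) * (q : ℝ) ^ m := by positivity
    have hE1' : omega ℂ * (Real.log a + m * Real.log q) ≤
        Real.log Cε + (1 + ε) * ((3 * m : ℕ) : ℝ) * Real.log ρ := by
      have hl := Real.log_le_log (Real.rpow_pos_of_pos (by positivity) _) hE1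
      rw [Real.log_rpow (by positivity), Real.log_mul hCε.ne' (Real.rpow_pos_of_pos hρ _).ne',
        Real.log_rpow hρ] at hl
      have : Real.log (((a * q ^ m : ℕ) : ℝ)) = Real.log a + m * Real.log q := by
        push_cast
        rw [Real.log_mul ha0.ne' (by positivity), Real.log_pow]
      rw [this] at hl
      linarith
    -- (E2) `log a ≥ log X - log 2`
    have hE2 : Real.log X - Real.log 2 ≤ Real.log a := by
      have := Real.log_le_log (by linarith) haX'
      rwa [Real.log_div (by linarith) (by norm_num)] at this
    -- combine
    have hκ : 0 < omega ℂ / (omega ℂ + δ) := div_pos hω0 hωδ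
    have hcomb : omega ℂ * ((m * L - 12 * √(m : ℝ) - Real.log 96 - Real.log Cδ) / (omega ℂ + δ)
        - Real.log 2) + omega ℂ * (m * Real.log q) ≤
        Real.log Cε + 3 * (1 + ε) * Real.log ρ * m := by
      have h1 : (m * L - 12 * √(m : ℝ) - Real.log 96 - Real.log Cδ) / (omega ℂ + δ) ≤
          Real.log X := by
        rw [hlogX]
        exact div_le_div_of_nonneg_right (by linarith) hωδ.le
      have h2 : omega ℂ * ((m * L - 12 * √(m : ℝ) - Real.log 96 - Real.log Cδ) / (omega ℂ + δ)
          - Real.log 2) ≤ omega ℂ * Real.log a :=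
        mul_le_mul_of_nonneg_left (by linarith) hω0.le
      have h3 : ((3 * m : ℕ) : ℝ) = 3 * m := by push_cast; ring
      rw [h3] at hE1'
      nlinarith [hE1', h2]
    have e1 : omega ℂ * ((m * L - 12 * √(m : ℝ) - Real.log 96 - Real.log Cδ) / (omega ℂ + δ)
        - Real.log 2) + omega ℂ * (m * Real.log q) =
        omega ℂ * (L / (omega ℂ + δ) + Real.log q) * m -
        (12 * (omega ℂ / (omega ℂ + δ)) * √(m : ℝ) +
          (omega ℂ / (omega ℂ + δ) * (Real.log 96 + Real.log Cδ) + omega ℂ * Real.log 2)) := by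
      field_simp
      ring
    rw [e1] at hcomb
    linarith
  -- from the main claim: `L - δ + ω log q ≤ 3(1+ε) log ρ`
  have main' : ∀ ε : ℝ, 0 < ε → ∀ δ : ℝ, 0 < δ →
      L - δ + omega ℂ * Real.log q ≤ 3 * (1 + ε) * Real.log ρ := by
    intro ε hε δ hδ
    have h := main ε hε δ hδ
    have hωδ : 0 < omega ℂ + δ := by linarith
    have h1 : L - δ ≤ omega ℂ * (L / (omega ℂ + δ)) := by
      rw [mul_div_assoc', le_div_iff₀ hωδ]
      nlinarith
    nlinarith
  -- `L + ω log q ≤ 3 log ρ`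
  have key : L + omega ℂ * Real.log q ≤ 3 * Real.log ρ := by
    refine le_of_forall_pos_le_add fun η hη => ?_
    set ε : ℝ := η / (2 * (3 * |Real.log ρ| + 1)) with hε
    have hε0 : 0 < ε := by positivity
    have h := main' ε hε0 (η / 2) (by positivity)
    have h1 : 3 * ε * Real.log ρ ≤ η / 2 := by
      calc 3 * ε * Real.log ρ ≤ 3 * ε * |Real.log ρ| :=
            mul_le_mul_of_nonneg_left (le_abs_self _) (by positivity)
        _ = η / 2 * (3 * |Real.log ρ| / (3 * |Real.log ρ| + 1)) := by rw [hε]; field_simp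
        _ ≤ η / 2 * 1 := by
            refine mul_le_mul_of_nonneg_left ?_ (by positivity)
            rw [div_le_one (by positivity)]; linarith
        _ = η / 2 := mul_one _
    nlinarith
  -- conclusion
  have hy : 0 < 4 * ρ ^ 3 / 27 := by positivity
  rw [Real.le_logb_iff_rpow_le hq1 hy, ← Real.log_le_log_iff (Real.rpow_pos_of_pos hq0 _) hy,
    Real.log_rpow hq0]
  have : Real.log (4 * ρ ^ 3 / 27) = 3 * Real.log ρ - L := by
    rw [hL, Real.log_div (by positivity) (by norm_num), Real.log_mul (by norm_num) (by positivity),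
      Real.log_pow, Real.log_div (by norm_num) (by norm_num)]
    push_cast; ring
  rw [this]
  linarith

end Summit.MatrixMultiplication.MatrixMultiplication.Theorems

end
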